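import Literature.AlgebraicGeometry.ModuliOfAbelianVarieties.SiegelFineModuliArtinianLifting
import Literature.AlgebraicGeometry.Morphisms.ArtinianLiftsPrincipalSmallExtension
import HarnessLib

/-!
# Smoothness of a fine moduli scheme of polarised abelian schemes over `ℚ` from the Artinian lifting of triples along
# PRINCIPAL small extensions ([EGAIV4] (17.14.2) + [Schlessinger1968] (1.2)–(1.3), read through «fine moduli»)

Layer `Literature/AlgebraicGeometry/ModuliOfAbelianVarieties`, namespace
`Literature.AlgebraicGeometry.ModuliOfAbelianVarieties.SiegelFineModuliScheme`.  THEOREMS ONLY (no definition, no named fact, no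
instance, no notation, no `sorry`).  Cell `hodgecm-mathlib` (D-0151 ∕ D-0183 FLOOR 0), P1 sub-line F-11 ROAD A, junction sharpening
«J2-b» (F0P1b-p01 (g0); author of the line B-p05 (g19), FIT 21:42:34Z).  HC_CM is proved only modulo the 7 printed citations until
rung 0 closes; this file discharges none of them.

THE POINT.  ★ `SiegelFineModuliArtinianLifting` (rows (A1)+(A6) of road A; B-p05 (g18∕g19)) turns «every triple over `Spec (A⧸J)`
is a pull-back of a triple over `Spec A`» — for ALL ideals `J` with `𝔪_A J = 0` of all Artinian local `ℚ`-algebras `A` — into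
`Smooth 𝓜.M.hom`.  By [Schlessinger1968] (1.2)–(1.3) ([Hartshorne2010] §16: «any surjective map can be factored into a finite number
of small extensions») it suffices to lift along PRINCIPAL small extensions `A ↠ A⧸(t)`, `t ∈ 𝔪_A`, `t ≠ 0`, `𝔪_A·t = 0` — the ring-level
reduction is ★ `Morphisms.isSmoothAt_of_principalArtinianLifts` (`Morphisms/ArtinianLiftsPrincipalSmallExtension`).  This file re-runs
the (A1) chart∕classification argument of ★ `SiegelFineModuliArtinianLifting` §1 VERBATIM over that criterion, so that the road-A
producers owe their lifts only along principal small extensions (where e.g. ★ `Deformation/InvertibleSheafExtensionsFlatSmallExtension`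
— Hartshorne DT Thm. 6.4 for flat deformations, principal `J` — applies as typed, and all obstruction ∕ torsor groups are the plain
`Hⁱ(X_s, ·)` of the closed fibre).  `t ∈ 𝔪_A` makes `A⧸(t) ≠ 0`, so the unsatisfiable `J = ⊤` corner of the edition-1 letter
(B-p05 (g19) finding 18:16Z, census §12) does not arise.  SECOND SHARPENING (J2 (a), F0P1b-p03 (g0) ∕ B-p05 (g19) 21:48Z): the test
algebras may be assumed to have residue field FINITE over `ℚ` — `[Module.Finite ℚ (ResidueField A)]` is handed to the producer
(honest: the test algebras of (17.14.2) are augmented to the residue field `κ(x)` of a CLOSED point of the finite-type `ℚ`-scheme `𝓜.M`,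
finite over `ℚ` by Zariski's lemma, Mathlib `finite_of_finite_type_of_isJacobsonRing`, and `k_A ↪ κ(x)` because `A` is Artinian local);
it is the bridge `k_A ↪ ℂ` to the tree's `ℂ`-side abelian-variety capital (`h¹(𝒪) = g`, Dolbeault bound, …).

* §0 plumbing (as in ★ §0; private, folklore): ring maps out of `Γ(Spec ℚ, 𝒪) ≅ ℚ` are unique; morphisms to `Spec ℚ` are unique;
  an open of a Jacobson space containing all closed points is everything.
* §1 **`mem_smoothLocus_of_isClosed_of_forall_principalSmallExtension`** — (A1♯) at ONE closed point (test algebras: residue field finite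
  over `ℚ`, extensions principal).
* §2 **`smooth_of_forall_principalSmallExtension_exists_isBaseChangeVia`** — (A6♯) `Smooth 𝓜.M.hom`.

## References
* [EGAIV4] A. Grothendieck, J. Dieudonné, *Éléments de géométrie algébrique* IV₄, Publ. Math. IHÉS 32 (1967), Prop. (17.14.1)–(17.14.2) (p. 98).
* [Schlessinger1968] M. Schlessinger, *Functors of Artin rings*, Trans. AMS 130 (1968), Def. (1.2), (1.3).
* [Hartshorne2010] R. Hartshorne, *Deformation Theory*, GTM 257 (2010), §16 pp. 111–113.
* [MumfordFogartyKirwan1994] D. Mumford, J. Fogarty, F. Kirwan, *Geometric Invariant Theory*, 3rd ed. (1994), Ch. 7 §3 Thm. 7.9 (p. 139).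
* [Lan2013PELCompactifications] K.-W. Lan, *Arithmetic compactifications of PEL-type Shimura varieties* (2013), §2.2.1 (p. 130).
-/

noncomputable section

universe u

open CategoryTheory CategoryTheory.Limits AlgebraicGeometry IsLocalRing TopologicalSpace

namespace Literature.AlgebraicGeometry.ModuliOfAbelianVarieties

open Literature.AlgebraicGeometry.Motives (SchemeOver specOver)
open Literature.AlgebraicGeometry.AbelianSchemes (PolarizedAbelianSchemeWithLevel)

namespace SiegelFineModuliScheme

/-! ## §0 Plumbing (as in ★ `SiegelFineModuliArtinianLifting` §0) -/

/-- Ring homomorphisms out of a ring isomorphic to `ℚ` agree (Mathlib `Rat.subsingleton_ringHom`, transported along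
`e : ℚ ≃+* R`). [folklore] -/
private theorem ringHom_ext_of_ratEquiv' {R A : Type*} [Semiring R] [Semiring A] (e : ℚ ≃+* R) (φ ψ : R →+* A) :
    φ = ψ := by
  have h : φ.comp e.toRingHom = ψ.comp e.toRingHom := Subsingleton.elim _ _
  refine RingHom.ext fun r => ?_
  obtain ⟨q, rfl⟩ := e.surjective r
  exact congr($h q)

/-- Any two morphisms of schemes `X → Spec ℚ` coincide. [folklore] -/
private theorem hom_ext_specRat' {X : Scheme.{0}} (a b : X ⟶ Spec (.of ℚ)) : a = b := by
  apply (ΓSpec.adjunction.homEquiv X (Opposite.op (CommRingCat.of ℚ))).symm.injective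
  apply Quiver.Hom.unop_inj
  ext1
  exact Subsingleton.elim _ _

/-- In a Jacobson space an open subset containing every closed point is the whole space. [folklore] -/
private theorem opens_eq_top_of_closedPoints_subset' {X : Type*} [TopologicalSpace X] [JacobsonSpace X] (U : Opens X)
    (h : closedPoints X ⊆ (U : Set X)) : U = ⊤ := by
  by_contra hU
  have hne : ((U : Set X)ᶜ).Nonempty := by
    rw [Set.nonempty_compl]
    exact fun h' => hU (Opens.ext (h'.trans Opens.coe_top.symm))
  obtain ⟨y, hyU, hy⟩ := nonempty_inter_closedPoints hne U.2.isClosed_compl.isLocallyClosed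
  exact hyU (h hy)

/-! ## §1 (A1♯) One closed point: lifting of triples along PRINCIPAL small extensions ⟹ the point is in the smooth locus -/

variable {g N : ℕ} {δ : Fin g → ℕ} (𝓜 : SiegelFineModuliScheme g N δ)

set_option backward.isDefEq.respectTransparency false in
/-- **(A1♯) EGA IV₄ (17.14.2) through «fine moduli» at a closed point — PRINCIPAL small extensions only.**  Let `𝓜` be a fine
moduli scheme of polarised abelian schemes of type `δ` with symplectic level-`N` structure over `ℚ`, locally of finite type over `ℚ`,
and `x` a closed point.  If for every Artinian local `ℚ`-algebra `A` WITH RESIDUE FIELD FINITE OVER `ℚ` and every `t ∈ 𝔪_A` with `t ≠ 0`,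
`𝔪_A·t = 0`, every triple over `Spec (A⧸(t))` is the pull-back of a triple over `Spec A`, then `x` lies in the smooth locus of
`𝓜.M → Spec ℚ`.  Proof = ★
`mem_smoothLocus_of_isClosed_of_forall_smallExtension` (B-p05) verbatim — affine chart `W = Spec C ∋ x`, a test map `C → A⧸(t)` is an
`A⧸(t)`-point of `𝓜.M`, pull back the universal triple, lift by hypothesis, classify the lift, the classifying map factors through the
chart and is the ring lift — over the principal criterion ★ `Morphisms.isSmoothAt_of_principalArtinianLifts` ([Schlessinger1968] (1.3)).
[cite: EGAIV4, Prop. (17.14.2), p. 98] [cite: MumfordFogartyKirwan1994, Ch. 7 §3 Theorem 7.9 (p. 139)]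
[cite: Hartshorne2010, §16, pp. 111–113 (small extensions; proof of Thm. 16.2)] -/
theorem mem_smoothLocus_of_isClosed_of_forall_principalSmallExtension [LocallyOfFiniteType 𝓜.M.hom]
    (H : ∀ (A : Type) [CommRing A] [Algebra ℚ A] [IsArtinianRing A] [IsLocalRing A]
      [Module.Finite ℚ (ResidueField A)] (t : A),
      t ≠ 0 → t ∈ maximalIdeal A → maximalIdeal A * Ideal.span {t} = ⊥ →
      ∀ P₀ : PolarizedAbelianSchemeWithLevel g N δ (Spec (.of (A ⧸ Ideal.span {t}))),
        ∃ (P : PolarizedAbelianSchemeWithLevel g N δ (Spec (.of A)))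
          (G : P₀.A.X.left ⟶ P.A.X.left) (Ĝ : P₀.D.hat.X.left ⟶ P.D.hat.X.left),
          P₀.IsBaseChangeVia P (Spec.map (CommRingCat.ofHom (Ideal.Quotient.mk (Ideal.span {t})))) G Ĝ)
    (x : 𝓜.M.left) (hx : IsClosed ({x} : Set 𝓜.M.left)) : x ∈ 𝓜.M.hom.smoothLocus := by
  classical
  -- (b) the affine chart: `W ∋ x` in `𝓜.M`, the whole of `Spec ℚ` on the base
  have hU : IsAffineOpen (⊤ : (Spec (CommRingCat.of ℚ)).Opens) := isAffineOpen_top _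
  obtain ⟨_, ⟨W, hW, rfl⟩, hxW, -⟩ :=
    𝓜.M.left.isBasis_affineOpens.exists_subset_of_mem_open (Set.mem_univ x) isOpen_univ
  have hWU : W ≤ 𝓜.M.hom ⁻¹ᵁ ⊤ := le_top
  haveI : IsNoetherianRing Γ(Spec (CommRingCat.of ℚ), ⊤) := IsLocallyNoetherian.component_noetherian ⟨⊤, hU⟩
  have hft : (𝓜.M.hom.appLE ⊤ W hWU).hom.FiniteType := 𝓜.M.hom.finiteType_appLE hU hW hWU
  algebraize [(𝓜.M.hom.appLE ⊤ W hWU).hom]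
  rw [Scheme.Hom.mem_smoothLocus, formallySmooth_stalkMap_iff ⊤ hU W hW hWU hxW]
  change Algebra.IsSmoothAt Γ(Spec (CommRingCat.of ℚ), ⊤) (hW.primeIdealOf ⟨x, hxW⟩).asIdeal
  -- (c) the closed point as a surjection `C ↠ C ⧸ q`, `q` maximal
  haveI hqmax : (hW.primeIdealOf ⟨x, hxW⟩).asIdeal.IsMaximal := hW.primeIdealOf_isMaximal_of_isClosed ⟨x, hxW⟩ hx
  letI := Ideal.Quotient.field (hW.primeIdealOf ⟨x, hxW⟩).asIdeal
  refine Literature.AlgebraicGeometry.Morphisms.isSmoothAt_of_principalArtinianLifts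
    (Ideal.Quotient.mkₐ Γ(Spec (CommRingCat.of ℚ), ⊤) (hW.primeIdealOf ⟨x, hxW⟩).asIdeal)
    (Ideal.Quotient.mkₐ_surjective Γ(Spec (CommRingCat.of ℚ), ⊤) _) (hW.primeIdealOf ⟨x, hxW⟩).asIdeal
    (Ideal.Quotient.mkₐ_ker Γ(Spec (CommRingCat.of ℚ), ⊤) _) ?_
  -- (d) the lifting property along the principal small extension `A ↠ A ⧸ (t)`
  intro A _ _ _ _ t ht0 htm htJ g₀ ε hε
  -- `A` as a `ℚ`-algebra (through `Γ(Spec ℚ, 𝒪) ≅ ℚ`)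
  let e : ℚ ≃+* Γ(Spec (CommRingCat.of ℚ), ⊤) := (Scheme.ΓSpecIso (CommRingCat.of ℚ)).commRingCatIsoToRingEquiv.symm
  letI : Algebra ℚ A := ((algebraMap Γ(Spec (CommRingCat.of ℚ), ⊤) A).comp e.toRingHom).toAlgebra
  -- (d′) the residue field of `A` is FINITE over `ℚ`: it embeds (through `ε`) into `κ(x) = C ⧸ q`, which is of finite type,
  -- hence finite, over the field `Γ(Spec ℚ, 𝒪) ≅ ℚ` (Zariski's lemma, Mathlib `finite_of_finite_type_of_isJacobsonRing`)
  haveI : Module.Finite ℚ (ResidueField A) := by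
    letI : Algebra ℚ Γ(Spec (CommRingCat.of ℚ), ⊤) := e.toRingHom.toAlgebra
    haveI : IsScalarTower ℚ Γ(Spec (CommRingCat.of ℚ), ⊤) A := IsScalarTower.of_algebraMap_eq fun _ => rfl
    haveI : Module.Finite ℚ Γ(Spec (CommRingCat.of ℚ), ⊤) :=
      Module.Finite.of_surjective (Algebra.linearMap ℚ Γ(Spec (CommRingCat.of ℚ), ⊤)) e.surjective
    haveI : IsJacobsonRing Γ(Spec (CommRingCat.of ℚ), ⊤) := isJacobsonRing_of_surjective ⟨e.toRingHom, e.surjective⟩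
    haveI : Module.Finite Γ(Spec (CommRingCat.of ℚ), ⊤) (Γ(𝓜.M.left, W) ⧸ (hW.primeIdealOf ⟨x, hxW⟩).asIdeal) :=
      finite_of_finite_type_of_isJacobsonRing _ _
    -- `A → A ⧸ (t) → κ(x)` kills `𝔪_A` (its kernel is a prime, hence the maximal ideal of the Artinian local ring `A`)
    let φ : A →ₐ[Γ(Spec (CommRingCat.of ℚ), ⊤)] Γ(𝓜.M.left, W) ⧸ (hW.primeIdealOf ⟨x, hxW⟩).asIdeal :=
      ε.comp (Ideal.Quotient.mkₐ _ (Ideal.span {t}))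
    haveI : (RingHom.ker φ.toRingHom).IsPrime := RingHom.ker_isPrime φ.toRingHom
    have hker : RingHom.ker φ.toRingHom = maximalIdeal A :=
      IsLocalRing.eq_maximalIdeal (IsArtinianRing.isMaximal_of_isPrime _)
    let ψ : ResidueField A →ₐ[Γ(Spec (CommRingCat.of ℚ), ⊤)] Γ(𝓜.M.left, W) ⧸ (hW.primeIdealOf ⟨x, hxW⟩).asIdeal :=
      Ideal.Quotient.liftₐ (maximalIdeal A) φ fun a ha => by
        rw [← hker] at ha
        exact ha
    have hψ : Function.Injective ψ := ψ.toRingHom.injective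
    haveI : Module.Finite Γ(Spec (CommRingCat.of ℚ), ⊤) (ResidueField A) :=
      Module.Finite.of_injective ψ.toLinearMap fun a b h => hψ h
    exact Module.Finite.trans Γ(Spec (CommRingCat.of ℚ), ⊤) (ResidueField A)
  -- the `A ⧸ (t)`-point of `𝓜.M` through the chart and the pulled-back universal triple
  let t₀ : Spec (CommRingCat.of (A ⧸ Ideal.span {t})) ⟶ 𝓜.M.left :=
    Spec.map (CommRingCat.ofHom g₀.toRingHom) ≫ hW.fromSpec
  obtain ⟨P, G, Ĝ, hP⟩ := H A t ht0 htm htJ (𝓜.univ.baseChange t₀)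
  -- classify the lift over `Spec A`
  let T : SchemeOver ℚ := specOver ℚ A
  let T₀ : SchemeOver ℚ := specOver ℚ (A ⧸ Ideal.span {t})
  haveI : IsLocallyNoetherian T.left := inferInstanceAs (IsLocallyNoetherian (Spec (CommRingCat.of A)))
  haveI : IsLocallyNoetherian T₀.left :=
    inferInstanceAs (IsLocallyNoetherian (Spec (CommRingCat.of (A ⧸ Ideal.span {t}))))
  let i : Spec (CommRingCat.of (A ⧸ Ideal.span {t})) ⟶ Spec (CommRingCat.of A) :=
    Spec.map (CommRingCat.ofHom (Ideal.Quotient.mk (Ideal.span {t})))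
  let s : T₀ ⟶ T := Over.homMk i (hom_ext_specRat' _ _)
  let tA : Spec (CommRingCat.of A) ⟶ 𝓜.M.left := (𝓜.classifyingMap T P).left
  let t₀' : T₀ ⟶ 𝓜.M := Over.homMk t₀ (hom_ext_specRat' _ _)
  have ht₀ : t₀' = 𝓜.classifyingMap T₀ (𝓜.univ.baseChange t₀) :=
    𝓜.eq_classifyingMap T₀ (𝓜.univ.baseChange t₀) t₀' ⟨_, _, 𝓜.univ.baseChange_isBaseChangeVia t₀⟩
  have hs : s ≫ 𝓜.classifyingMap T P = 𝓜.classifyingMap T₀ (𝓜.univ.baseChange t₀) :=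
    𝓜.classifyingMap_comp s P (𝓜.univ.baseChange t₀) hP
  have hlift : i ≫ tA = t₀ := by
    have h := congrArg CommaMorphism.left (hs.trans ht₀.symm)
    simp only [s, t₀', Over.comp_left, Over.homMk_left] at h
    exact h
  -- (e) `tA` lands in `W`: `Spec A` is one point, hit by `Spec (A ⧸ (t))`
  haveI : Nontrivial (A ⧸ Ideal.span {t}) := ε.toRingHom.domain_nontrivial
  have hsurj : Function.Surjective i := by
    intro y
    obtain ⟨M, hM⟩ := Ideal.exists_maximal (A ⧸ Ideal.span {t})
    refine ⟨(⟨M, hM.isPrime⟩ : PrimeSpectrum (A ⧸ Ideal.span {t})), PrimeSpectrum.ext ?_⟩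
    rw [IsLocalRing.eq_maximalIdeal (IsArtinianRing.isMaximal_of_isPrime y.asIdeal)]
    exact IsLocalRing.eq_maximalIdeal (IsArtinianRing.isMaximal_of_isPrime _)
  have hpt : ∀ y, tA y ∈ W := by
    intro y
    obtain ⟨z, rfl⟩ := hsurj y
    rw [← Scheme.Hom.comp_apply, hlift, Scheme.Hom.comp_apply]
    have := Set.mem_range_self (f := fun u => hW.fromSpec u) (Spec.map (CommRingCat.ofHom g₀.toRingHom) z)
    rwa [hW.range_fromSpec] at this
  have hrange : Set.range tA ⊆ Set.range (Scheme.Opens.ι W) := by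
    rintro _ ⟨y, rfl⟩
    rw [Scheme.Opens.range_ι]
    exact hpt y
  let ℓ := IsOpenImmersion.lift (Scheme.Opens.ι W) tA hrange
  have hℓ : ℓ ≫ Scheme.Opens.ι W = tA := IsOpenImmersion.lift_fac _ tA hrange
  obtain ⟨gC, hgC⟩ := Spec.map_surjective (ℓ ≫ hW.isoSpec.hom)
  have hgC' : Spec.map gC ≫ hW.fromSpec = tA := by
    rw [hgC, Category.assoc, ← IsAffineOpen.isoSpec_inv_ι, Iso.hom_inv_id_assoc, hℓ]
  -- (f) the ring map `gC : C → A` is an algebra lift of `g₀`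
  have hR1 : 𝓜.M.hom.appLE ⊤ W hWU ≫ gC = CommRingCat.ofHom (algebraMap Γ(Spec (CommRingCat.of ℚ), ⊤) A) := by
    ext1
    exact ringHom_ext_of_ratEquiv' e _ _
  have hR2 : gC ≫ CommRingCat.ofHom (Ideal.Quotient.mk (Ideal.span {t})) = CommRingCat.ofHom g₀.toRingHom := by
    have h := hlift
    rw [← hgC', ← Spec.map_comp_assoc, cancel_mono] at h
    exact Spec.map_injective h
  let gA : Γ(𝓜.M.left, W) →ₐ[Γ(Spec (CommRingCat.of ℚ), ⊤)] A :=
    ⟨gC.hom, fun r => congr(($hR1).hom r)⟩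
  refine ⟨gA, AlgHom.ext fun c => ?_⟩
  exact congr(($hR2).hom c)

/-! ## §2 (A6♯) Glue over the closed points -/

/-- **(A6♯) F-11 from the Artinian lifting of triples along PRINCIPAL small extensions.**  Let `𝓜` be a fine moduli scheme of
polarised abelian schemes of type `δ` with symplectic level-`N` structure over `ℚ`, locally of finite type over `ℚ`.  If for every
Artinian local `ℚ`-algebra `A` with residue field finite over `ℚ` and every `t ∈ 𝔪_A` with `t ≠ 0` and `𝔪_A·t = 0` every triple over
`Spec (A⧸(t))` is the pull-back of a triple over `Spec A`, then **`𝓜.M → Spec ℚ` is smooth** (§1 at every closed point; the smooth locus is open and `𝓜.M` is Jacobson —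
as ★ `smooth_of_forall_smallExtension_exists_isBaseChangeVia`).  The `hF11` junction of ROAD A in the letter of [Schlessinger1968]
(1.2): producers lift only along principal small extensions. [cite: EGAIV4, Prop. (17.14.2), p. 98]
[cite: MumfordFogartyKirwan1994, Ch. 7 §3 Theorem 7.9 (p. 139)] [cite: Hartshorne2010, §16, pp. 111–113 (small extensions; proof of Thm. 16.2)] -/
theorem smooth_of_forall_principalSmallExtension_exists_isBaseChangeVia [LocallyOfFiniteType 𝓜.M.hom]
    (H : ∀ (A : Type) [CommRing A] [Algebra ℚ A] [IsArtinianRing A] [IsLocalRing A]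
      [Module.Finite ℚ (ResidueField A)] (t : A),
      t ≠ 0 → t ∈ maximalIdeal A → maximalIdeal A * Ideal.span {t} = ⊥ →
      ∀ P₀ : PolarizedAbelianSchemeWithLevel g N δ (Spec (.of (A ⧸ Ideal.span {t}))),
        ∃ (P : PolarizedAbelianSchemeWithLevel g N δ (Spec (.of A)))
          (G : P₀.A.X.left ⟶ P.A.X.left) (Ĝ : P₀.D.hat.X.left ⟶ P.D.hat.X.left),
          P₀.IsBaseChangeVia P (Spec.map (CommRingCat.ofHom (Ideal.Quotient.mk (Ideal.span {t})))) G Ĝ) :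
    Smooth 𝓜.M.hom := by
  rw [← Scheme.Hom.smoothLocus_eq_top_iff]
  haveI : JacobsonSpace 𝓜.M.left := LocallyOfFiniteType.jacobsonSpace 𝓜.M.hom
  exact opens_eq_top_of_closedPoints_subset' _ fun x hx =>
    𝓜.mem_smoothLocus_of_isClosed_of_forall_principalSmallExtension H x hx

end SiegelFineModuliScheme

end Literature.AlgebraicGeometry.ModuliOfAbelianVarieties

end
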